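import Literature.Geometry.Riemannian.SphericalCylinderSmallScaleDomination
import HarnessLib

/-!
# The large-scale half of the Cheeger–Yau bound for the typed zonal heat series of `S⁴`

Topic `Literature/Geometry/Riemannian` (companion of `SphericalCylinderSmallScaleDomination.lean`, which states
the named fact `CheegerYauZonalSphereFour`: `(8π²/3)(4πσ)⁻² e^{-arccos(c)²/4σ} ≤ 𝔥(σ, c)` for all `σ > 0`,
`c ∈ [-1, 1]`, where `𝔥 = zonal` is the typed Gegenbauer series of route `SmoothPoincare4/CylinderEntropy`).

Proved here: the regime `σ ≥ 1` of that fact, unconditionally, from the tree's large-scale estimate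
`one_sub_tail_le_zonal` (`𝔥(σ, c) ≥ 1 - e^{-σ}/(1 - e^{-σ})` for `σ ≥ 1`, `|c| ≤ 1`): for `σ ≥ 1` the
Cheeger–Yau minorant is at most `(8π²/3)/(16π²σ²) = 1/(6σ²) ≤ 1/6`, while `1 - e^{-σ}/(1 - e^{-σ}) ≥ 1/6`
(`e^{-σ} ≤ e^{-1} < 5/11`). So the debt carried by the fact is exactly its small-time half `0 < σ < 1`
(where the Gegenbauer eigen-expansion of the heat kernel and the parabolic comparison are needed). This
is also a consistency check of the normalisation `vol(S⁴) = 8π²/3` against the `k = 0` mode `1` of `𝔥`.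

References: J. Cheeger, S.-T. Yau, Comm. Pure Appl. Math. 34 (1981) 465–480; E. B. Davies,
*Heat kernels and spectral theory* (1989), Thm 5.6.1. [Davies1989] [CheegerYau1981]
-/

noncomputable section

namespace Literature.Geometry.Riemannian

open SphericalCylinderEntropy

/-- `e⁻¹ < 5/11` (from `e > 2.7182818283`). [folklore] -/
theorem exp_neg_one_lt_five_div_eleven : Real.exp (-1) < 5 / 11 := by
  have he : (2.7182818283 : ℝ) < Real.exp 1 := Real.exp_one_gt_d9
  rw [Real.exp_neg, inv_lt_comm₀ (Real.exp_pos 1) (by norm_num)]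
  linarith

/-- For `σ ≥ 1` the geometric tail `t(σ) = e^{-σ}/(1 - e^{-σ})` is at most `5/6`. [folklore] -/
theorem tail_le_five_div_six {σ : ℝ} (hσ : 1 ≤ σ) : tail σ ≤ 5 / 6 := by
  have hx1 : Real.exp (-σ) ≤ Real.exp (-1) := Real.exp_le_exp.2 (by linarith)
  have hx : Real.exp (-σ) < 5 / 11 := hx1.trans_lt exp_neg_one_lt_five_div_eleven
  have hx0 : 0 < Real.exp (-σ) := Real.exp_pos _
  have hden : 0 < 1 - Real.exp (-σ) := by linarith
  rw [tail, div_le_div_iff₀ hden (by norm_num : (0 : ℝ) < 6)]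
  nlinarith

/-- **Cheeger–Yau on the typed zonal series, large-scale half (`σ ≥ 1`), proved:**
`(8π²/3)(4πσ)⁻² e^{-arccos(c)²/4σ} ≤ 𝔥(σ, c)` for `σ ≥ 1`, `c ∈ [-1, 1]` — the minorant is `≤ 1/6` and
`𝔥 ≥ 1 - t(σ) ≥ 1/6` by `one_sub_tail_le_zonal`. The small-time half `0 < σ < 1` is the named fact
`CheegerYauZonalSphereFour`. [cite: Davies1989, Thm 5.6.1] -/
theorem cheegerYauZonal_of_one_le {σ : ℝ} (hσ : 1 ≤ σ) {c : ℝ} (hc₁ : -1 ≤ c) (hc₂ : c ≤ 1) :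
    (8 * Real.pi ^ 2 / 3) * ((4 * Real.pi * σ) ^ 2)⁻¹ * Real.exp (-(Real.arccos c) ^ 2 / (4 * σ)) ≤
      zonal σ c := by
  have habs : |c| ≤ 1 := abs_le.2 ⟨hc₁, hc₂⟩
  have hz : 1 - tail σ ≤ zonal σ c := one_sub_tail_le_zonal hσ habs
  have ht : tail σ ≤ 5 / 6 := tail_le_five_div_six hσ
  have hπ : 0 < Real.pi := Real.pi_pos
  have hσ0 : 0 < σ := by linarith
  -- the exponential factor is at most one
  have hexp : Real.exp (-(Real.arccos c) ^ 2 / (4 * σ)) ≤ 1 := by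
    rw [Real.exp_le_one_iff, neg_div]
    exact neg_nonpos.2 (div_nonneg (sq_nonneg _) (by linarith))
  -- the prefactor is `1/(6σ²) ≤ 1/6`
  have hpre : (8 * Real.pi ^ 2 / 3) * ((4 * Real.pi * σ) ^ 2)⁻¹ = 1 / (6 * σ ^ 2) := by
    field_simp
    ring
  have hpre_le : (8 * Real.pi ^ 2 / 3) * ((4 * Real.pi * σ) ^ 2)⁻¹ ≤ 1 / 6 := by
    rw [hpre, div_le_div_iff₀ (by positivity) (by norm_num : (0 : ℝ) < 6)]
    nlinarith
  have hpre0 : 0 ≤ (8 * Real.pi ^ 2 / 3) * ((4 * Real.pi * σ) ^ 2)⁻¹ := by positivity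
  calc (8 * Real.pi ^ 2 / 3) * ((4 * Real.pi * σ) ^ 2)⁻¹ * Real.exp (-(Real.arccos c) ^ 2 / (4 * σ))
      ≤ (1 / 6) * 1 := mul_le_mul hpre_le hexp (Real.exp_pos _).le (by norm_num)
    _ ≤ 1 - tail σ := by linarith
    _ ≤ zonal σ c := hz

/-- Hence the named fact `CheegerYauZonalSphereFour` is EQUIVALENT to its small-time half: it holds as soon
as the bound holds for `0 < σ < 1`. [cite: Davies1989, Thm 5.6.1] -/
theorem cheegerYauZonalSphereFour_of_lt_one
    (h : ∀ σ : ℝ, 0 < σ → σ < 1 → ∀ c : ℝ, -1 ≤ c → c ≤ 1 →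
      (8 * Real.pi ^ 2 / 3) * ((4 * Real.pi * σ) ^ 2)⁻¹ * Real.exp (-(Real.arccos c) ^ 2 / (4 * σ)) ≤
        zonal σ c) :
    CheegerYauZonalSphereFour := by
  intro σ hσ c hc₁ hc₂
  rcases lt_or_ge σ 1 with hlt | hge
  · exact h σ hσ hlt c hc₁ hc₂
  · exact cheegerYauZonal_of_one_le hge hc₁ hc₂

end Literature.Geometry.Riemannian

end
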